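import Literature.NumberTheory.EllipticCurves.SemistableModPImageProofs
import Literature.NumberTheory.EllipticCurves.IsogenyQuotientCurveProofs
import Literature.NumberTheory.EllipticCurves.NonEisensteinPrimeOfSurjective
import Literature.NumberTheory.EllipticCurves.RationalIsogenyDegreesProofs
import Literature.NumberTheory.EllipticCurves.IsogenyGeomEndRingOrdinaryCommProofs
import Literature.NumberTheory.EllipticCurves.BSDWave0
import HarnessLib

/-!
# Semistable curves with full rational `2`-torsion have irreducible `E[p]`, `p ≥ 5`, granted
# Mazur's torsion theorem (Serre 1987, §4.1 Prop. 6; Ribet 1997, Prop. 1, semistable case)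

`Proofs` file (theorems only: no definitions, no named facts), topic `NumberTheory/EllipticCurves`;
sibling of `RationalTwoTorsionModPIrreducibleProofs` (the same conclusion for EVERY curve with full
rational `2`-torsion, from the Mazur–Kenku classification `mazurKenku_exists_cyclic_isogeny`).  Here
the input is the other classical one, **Mazur's torsion theorem** (`mazur_torsion`, Mazur 1977,
Thm. 8 — "Ogg's conjecture"), and the curve is assumed semistable, exactly as in the printed proofs:

* K. Ribet, *On the equation `aᵖ + 2^α bᵖ + cᵖ = 0`*, Acta Arith. 79 (1997), Prop. 1, p. 11:
  "First suppose that `E` is semistable over `ℚ`.  Then, as was noted in [19], the result to be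
  proved follows easily from a theorem of Mazur [14, 15].  More precisely, suppose that `l ≥ 5` and
  that `E[l]` is reducible.  Then `E` has a rational subgroup `C` of order `l`.  The semistability
  hypothesis implies that the action of `Gal(ℚ̄/ℚ)` on `C` is ramified only at `l`, and a local
  study at `l` then shows that `Gal(ℚ̄/ℚ)` must act on `C` either trivially or via the mod `l`
  cyclotomic character.  This implies that some elliptic curve over `ℚ` which is isogenous to `E`
  contains a group of rational points which is isomorphic to `ℤ/2ℤ ⊕ ℤ/2lℤ`.  The existence of
  such a curve is incompatible with "Ogg's Conjecture", which was proved by Mazur in [14]."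
* J.-P. Serre, Duke Math. J. 54 (1987), §4.1, Prop. 6 (the same argument for the Frey curves of
  Fermat's equation).

## The proof over the tree

The "local study" and "`ℚ` has no unramified extension" are the tree's theorem
`Edixhoven1997_prop_2_1_holds` (`SemistableModPImageProofs`; Serre 1972, §5.4 Prop. 21): for a
semistable `E/ℚ` and a prime `p`, either `Γ_ℚ → Aut E[p]` is onto (hence `E[p]` is irreducible,
`hasIrreducibleModPGaloisRep_of_hasSurjectiveModNGaloisRep`), or there is a stable line `H ⊂ E[p]`
on which `Γ_ℚ` acts trivially (then `H ⊂ E(ℚ)` by Galois descent, `fixedPoints_eq_range_map_holds`)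
or modulo which `Γ_ℚ` acts trivially (then the quotient curve `E' = E/H`,
`exists_isogeny_ker_eq_and_comp_eq_nsmul_holds`, carries the rational point `g(T)` of order `p`,
`T ∈ E[p] ∖ H`, and the rational `2`-torsion `g(E[2]) ≅ E[2]`).  In both cases an elliptic curve
over `ℚ` has rational points `P₁ ≠ P₂` of order `2` and `Q` of order `p ≥ 5`, which Mazur's list
excludes (`false_of_mazur_torsion`: `ℤ/n` has at most one element of order `2`; in
`ℤ/2 × ℤ/2m`, `m ≤ 4`, every order divides `2m`, and `p ∤ 2m`).

## Main statements

* `false_of_mazur_torsion` — no `E/ℚ` with `mazur_torsion E` has rational `P₁ ≠ P₂` of order `2`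
  and `Q` of prime order `p ≥ 5`.
* `hasIrreducibleModPGaloisRep_of_isSemistable_of_rational_two_torsion_of_mazur_torsion` — THE
  THEOREM (Ribet 1997, Prop. 1, semistable case; Serre 1987, §4.1 Prop. 6).

## References

* [Ribet1997] K. A. Ribet, Acta Arith. 79 (1997) 7–16, Prop. 1 (p. 11–12).
* [Serre1987] J.-P. Serre, Duke Math. J. 54 (1987), §4.1 Prop. 6.
* [Mazur1977] B. Mazur, *Modular curves and the Eisenstein ideal*, Publ. Math. IHÉS 47 (1977),
  Thm. 8.
* [Serre1972] J.-P. Serre, Invent. Math. 15 (1972), §5.4 Prop. 21; [Edixhoven1997] Prop. 2.1.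

Design: no definitions, no named facts (`mazur_torsion` enters as the hypothesis
`hMT : ∀ V, mazur_torsion V`); general lemmas are deliberate dot-notation extensions in
`namespace ZMod` / `namespace WeierstrassCurve`; the `ℚ`-statements live in
`Literature.NumberTheory.EllipticCurves`.
-/

noncomputable section

open scoped Classical

universe u

/-! ### Two elements of order `2` in a cyclic group coincide -/

namespace ZMod

/-- In `ℤ/n` (`n ≥ 1`) two non-zero elements killed by `2` are equal (both are `n/2`). [folklore] -/
theorem eq_of_two_nsmul_eq_zero {n : ℕ} [NeZero n] {a b : ZMod n} (ha : 2 • a = 0) (hb : 2 • b = 0)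
    (ha0 : a ≠ 0) (hb0 : b ≠ 0) : a = b := by
  have key : ∀ {c : ZMod n}, 2 • c = 0 → c ≠ 0 → 2 * c.val = n := by
    intro c hc hc0
    have hlt : c.val < n := ZMod.val_lt c
    have hval0 : c.val ≠ 0 := fun h ↦ hc0 ((ZMod.val_eq_zero c).mp h)
    have hc' := hc
    rw [nsmul_eq_mul, Nat.cast_ofNat] at hc'
    have hcast : ((2 * c.val : ℕ) : ZMod n) = 0 := by
      rw [Nat.cast_mul, ZMod.natCast_zmod_val, Nat.cast_ofNat]
      exact hc'
    obtain ⟨k, hk⟩ := (ZMod.natCast_eq_zero_iff _ _).mp hcast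
    have hk1 : k = 1 := by
      rcases Nat.lt_or_ge k 2 with h | h
      · interval_cases k
        · omega
        · rfl
      · nlinarith [NeZero.pos n]
    rw [hk, hk1, mul_one]
  have h := (key ha ha0).trans (key hb hb0).symm
  exact ZMod.val_injective n (by omega)

end ZMod

namespace Literature.NumberTheory.EllipticCurves

-- `_root_`: the import closure declares `Literature.NumberTheory.EllipticCurves.WeierstrassCurve.*`
open _root_.WeierstrassCurve

/-! ### Mazur's list has no room for `ℤ/2 × ℤ/2 × ℤ/p`, `p ≥ 5` -/

/-- **No elliptic curve over `ℚ` satisfying Mazur's torsion theorem has rational points `P₁ ≠ P₂`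
of order `2` and `Q` of prime order `p ≥ 5`** (Ribet 1997, proof of Prop. 1: "a group of rational
points which is isomorphic to `ℤ/2ℤ ⊕ ℤ/2lℤ` … incompatible with Ogg's Conjecture"): in `ℤ/nℤ`
two elements of order `2` coincide, and in `ℤ/2 × ℤ/2m`, `m ≤ 4`, every element is killed by
`2m`, which `p ≥ 5` does not divide. [cite: Ribet1997, Prop. 1 (p. 11–12)] [cite: Mazur1977, Thm 8] -/
theorem false_of_mazur_torsion (V : WeierstrassCurve ℚ) [V.IsElliptic] (hMT : mazur_torsion V)
    {p : ℕ} (hp : p.Prime) (h5 : 5 ≤ p) {P₁ P₂ Q : V.toAffine.Point} (hP₁ : addOrderOf P₁ = 2)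
    (hP₂ : addOrderOf P₂ = 2) (h12 : P₁ ≠ P₂) (hQ : addOrderOf Q = p) : False := by
  -- the three points are torsion points
  have htors : ∀ {X : V.toAffine.Point} {k : ℕ}, addOrderOf X = k → k ≠ 0 →
      X ∈ AddCommGroup.torsion V.toAffine.Point := fun hX hk ↦ by
    rw [AddCommGroup.mem_torsion, ← addOrderOf_pos_iff, hX]
    exact Nat.pos_of_ne_zero hk
  set T := AddCommGroup.torsion V.toAffine.Point with hT
  have hP₁T : P₁ ∈ T := htors hP₁ two_ne_zero
  have hP₂T : P₂ ∈ T := htors hP₂ two_ne_zero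
  have hQT : Q ∈ T := htors hQ hp.ne_zero
  have hord₁ : addOrderOf (⟨P₁, hP₁T⟩ : T) = 2 := by rw [← AddSubgroup.addOrderOf_coe]; exact hP₁
  have hord₂ : addOrderOf (⟨P₂, hP₂T⟩ : T) = 2 := by rw [← AddSubgroup.addOrderOf_coe]; exact hP₂
  have hordQ : addOrderOf (⟨Q, hQT⟩ : T) = p := by rw [← AddSubgroup.addOrderOf_coe]; exact hQ
  rcases hMT with ⟨n, hn1, -, ⟨e⟩⟩ | ⟨m, hm1, hm4, ⟨e⟩⟩
  · -- cyclic torsion: the two points of order `2` coincide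
    haveI : NeZero n := ⟨by omega⟩
    have ha : addOrderOf (e ⟨P₁, hP₁T⟩) = 2 := by
      rw [AddEquiv.addOrderOf_eq, hord₁]
    have hb : addOrderOf (e ⟨P₂, hP₂T⟩) = 2 := by
      rw [AddEquiv.addOrderOf_eq, hord₂]
    have ha0 : e ⟨P₁, hP₁T⟩ ≠ 0 := fun h ↦ by
      rw [← AddMonoid.addOrderOf_eq_one_iff, ha] at h; exact absurd h (by decide)
    have hb0 : e ⟨P₂, hP₂T⟩ ≠ 0 := fun h ↦ by
      rw [← AddMonoid.addOrderOf_eq_one_iff, hb] at h; exact absurd h (by decide)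
    have h2a : 2 • e ⟨P₁, hP₁T⟩ = 0 := ha ▸ addOrderOf_nsmul_eq_zero _
    have h2b : 2 • e ⟨P₂, hP₂T⟩ = 0 := hb ▸ addOrderOf_nsmul_eq_zero _
    have heq := ZMod.eq_of_two_nsmul_eq_zero h2a h2b ha0 hb0
    exact h12 (congrArg Subtype.val (e.injective heq))
  · -- torsion `ℤ/2 × ℤ/2m`: every order divides `2m ≤ 8`
    have hc : addOrderOf (e ⟨Q, hQT⟩) = p := by
      rw [AddEquiv.addOrderOf_eq, hordQ]
    have hkill : (2 * m) • e ⟨Q, hQT⟩ = 0 := by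
      ext
      · change (2 * m) • (e ⟨Q, hQT⟩).1 = 0
        rw [nsmul_eq_mul, show ((2 * m : ℕ) : ZMod 2) = 0 from
          (ZMod.natCast_eq_zero_iff _ _).mpr (dvd_mul_right 2 m), zero_mul]
      · change (2 * m) • (e ⟨Q, hQT⟩).2 = 0
        rw [nsmul_eq_mul, ZMod.natCast_self, zero_mul]
    have hdvd : p ∣ 2 * m := hc ▸ addOrderOf_dvd_of_nsmul_eq_zero hkill
    rcases (Nat.Prime.dvd_mul hp).mp hdvd with h2 | hm
    · have := Nat.le_of_dvd two_pos h2; omega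
    · have := Nat.le_of_dvd (by omega) hm; omega

/-! ### Galois descent of a fixed geometric point, keeping its order -/

/-- A `Γ_ℚ`-fixed geometric point of `E` comes from a rational point of the same order (Galois
descent, `fixedPoints_eq_range_map_holds`, and injectivity of base change). [folklore] -/
theorem exists_addOrderOf_eq_of_forall_smul_eq (V : WeierstrassCurve ℚ) (P : V.geomPoints)
    (hP : ∀ σ : Field.absoluteGaloisGroup ℚ, σ • P = P) :
    ∃ P₀ : (V.baseChange ℚ).toAffine.Point,
      Affine.Point.baseChange ℚ (AlgebraicClosure ℚ) P₀ = P ∧ addOrderOf P₀ = addOrderOf P := by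
  have hfix : P ∈ MulAction.fixedPoints (Field.absoluteGaloisGroup ℚ) V.geomPoints := hP
  have hdesc : MulAction.fixedPoints (Field.absoluteGaloisGroup ℚ) (geomPoints V) =
      Set.range (fun P : (V.baseChange ℚ).toAffine.Point =>
        (Affine.Point.baseChange ℚ (AlgebraicClosure ℚ) P : geomPoints V)) :=
    fixedPoints_eq_range_map_holds V
  rw [hdesc] at hfix
  obtain ⟨P₀, hP₀⟩ := hfix
  refine ⟨P₀, hP₀, ?_⟩
  rw [← hP₀]
  exact (addOrderOf_injective (Affine.Point.baseChange ℚ (AlgebraicClosure ℚ))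
    (Affine.Point.map_injective _) P₀).symm

/-- **Three fixed geometric points — two of order `2`, one of prime order `p ≥ 5` — contradict
Mazur's torsion theorem for `E.baseChange ℚ`.** [cite: Ribet1997, Prop. 1 (p. 11–12)] -/
theorem false_of_mazur_torsion_of_forall_smul_eq (V : WeierstrassCurve ℚ) [V.IsElliptic]
    (hMT : mazur_torsion (V.baseChange ℚ)) {p : ℕ} (hp : p.Prime) (h5 : 5 ≤ p)
    {P₁ P₂ Q : V.geomPoints} (hP₁ : addOrderOf P₁ = 2) (hP₂ : addOrderOf P₂ = 2) (h12 : P₁ ≠ P₂)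
    (hQ : addOrderOf Q = p) (hσ₁ : ∀ σ : Field.absoluteGaloisGroup ℚ, σ • P₁ = P₁)
    (hσ₂ : ∀ σ : Field.absoluteGaloisGroup ℚ, σ • P₂ = P₂)
    (hσQ : ∀ σ : Field.absoluteGaloisGroup ℚ, σ • Q = Q) : False := by
  obtain ⟨R₁, hR₁, hoR₁⟩ := exists_addOrderOf_eq_of_forall_smul_eq V P₁ hσ₁
  obtain ⟨R₂, hR₂, hoR₂⟩ := exists_addOrderOf_eq_of_forall_smul_eq V P₂ hσ₂
  obtain ⟨S, hS, hoS⟩ := exists_addOrderOf_eq_of_forall_smul_eq V Q hσQ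
  refine false_of_mazur_torsion (V.baseChange ℚ) hMT hp h5 (P₁ := R₁) (P₂ := R₂) (Q := S)
    (hoR₁.trans hP₁) (hoR₂.trans hP₂) (fun h ↦ h12 ?_) (hoS.trans hQ)
  rw [← hR₁, ← hR₂, h]

/-! ### The theorem -/

/-- A point of `E(ℚ̄)` killed by `2` and by an odd prime `p` is `O`. [folklore] -/
theorem eq_zero_of_two_nsmul_of_prime_nsmul {V : WeierstrassCurve ℚ} {p : ℕ} (hp : p.Prime)
    (hp2 : p ≠ 2) {P : V.geomPoints} (h2 : 2 • P = 0) (hpP : p • P = 0) : P = 0 := by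
  have h1 : addOrderOf P ∣ 2 := addOrderOf_dvd_of_nsmul_eq_zero h2
  have h2' : addOrderOf P ∣ p := addOrderOf_dvd_of_nsmul_eq_zero hpP
  have hcop : Nat.Coprime 2 p := (Nat.coprime_primes Nat.prime_two hp).mpr (Ne.symm hp2)
  have : addOrderOf P ∣ 1 := hcop ▸ Nat.dvd_gcd h1 h2'
  rw [Nat.dvd_one, AddMonoid.addOrderOf_eq_one_iff] at this
  exact this

/-- **Ribet 1997, Prop. 1 (semistable case) / Serre 1987, §4.1 Prop. 6, from Mazur's torsion
theorem.**  Let `E/ℚ` be a SEMISTABLE elliptic curve all of whose `2`-torsion points are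
rational (`Γ_ℚ`-fixed), and let `p ≥ 5` be prime.  Granted Mazur's torsion theorem for every
elliptic curve over `ℚ` (`hMT`, the named fact `mazur_torsion`, Mazur 1977, Thm. 8), `E[p]` is an
irreducible `Γ_ℚ`-module.  Proof (Ribet, p. 11–12): by Serre's Prop. 21
(`Edixhoven1997_prop_2_1_holds`) either `ρ̄_{E,p}` is onto — then irreducible
(`hasIrreducibleModPGaloisRep_of_hasSurjectiveModNGaloisRep`) — or a stable line `H` has trivial
sub- or quotient character; in the first case `E(ℚ) ⊇ E[2] ⊕ H ≅ ℤ/2 ⊕ ℤ/2p`, in the second the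
quotient `E' = E/H` (`exists_isogeny_ker_eq_and_comp_eq_nsmul_holds`) has
`E'(ℚ) ⊇ g(E[2]) ⊕ ⟨g T⟩ ≅ ℤ/2 ⊕ ℤ/2p` (`T ∈ E[p] ∖ H`); both contradict `mazur_torsion`
(`false_of_mazur_torsion_of_forall_smul_eq`).
[cite: Ribet1997, Prop. 1 (p. 11–12)] [cite: Serre1987, §4.1 Prop. 6] [cite: Mazur1977, Thm 8] -/
theorem hasIrreducibleModPGaloisRep_of_isSemistable_of_rational_two_torsion_of_mazur_torsion
    (hMT : ∀ V : WeierstrassCurve ℚ, mazur_torsion V) (W : WeierstrassCurve ℚ) [W.IsElliptic]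
    (hW : W.IsSemistable ℤ)
    (h2 : ∀ (σ : Field.absoluteGaloisGroup ℚ) (P : W.geomPoints), 2 • P = 0 → σ • P = P)
    {p : ℕ} (hp : p.Prime) (h5 : 5 ≤ p) : W.HasIrreducibleModPGaloisRep p := by
  haveI : Fact p.Prime := ⟨hp⟩
  haveI : NeZero (p : ℚ) := ⟨Nat.cast_ne_zero.mpr hp.ne_zero⟩
  have hp2 : p ≠ 2 := by omega
  rcases Edixhoven1997_prop_2_1_holds W hW p hp with hsurj | ⟨H, hstab, hbot, htop, hH⟩
  · exact hasIrreducibleModPGaloisRep_of_hasSurjectiveModNGaloisRep W p hsurj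
  exfalso
  /- Two independent rational `2`-torsion points `P, Q`. -/
  have h2K : ((2 : ℕ) : ℚ) ≠ 0 := by norm_num
  haveI : Finite (geomTorsion W ((2 : ℕ) : ℤ)) := finite_geomTorsion_natCast W two_ne_zero
  obtain ⟨P, Q, hP2, hQ2, hP0, hQ0, hPQ⟩ :
      ∃ P Q : W.geomPoints, 2 • P = 0 ∧ 2 • Q = 0 ∧ P ≠ 0 ∧ Q ≠ 0 ∧ P ≠ Q := by
    haveI : Fintype (geomTorsion W ((2 : ℕ) : ℤ)) := Fintype.ofFinite _
    have h3 : 2 < Fintype.card (geomTorsion W ((2 : ℕ) : ℤ)) := by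
      rw [← Nat.card_eq_fintype_card, natCard_geomTorsion_eq_sq W h2K]; norm_num
    obtain ⟨a, b, c, hab, hac, hbc⟩ := Fintype.two_lt_card_iff.1 h3
    have mem2 : ∀ x : geomTorsion W ((2 : ℕ) : ℤ), 2 • (x : W.geomPoints) = 0 := fun x ↦
      AddSubgroup.torsionBy.nsmul_iff.1 x.2
    have hne : ∀ {x y : geomTorsion W ((2 : ℕ) : ℤ)}, x ≠ y → (x : W.geomPoints) ≠ y :=
      fun hxy h ↦ hxy (Subtype.ext h)
    by_cases ha : (a : W.geomPoints) = 0
    · refine ⟨b, c, mem2 b, mem2 c, fun hb ↦ hne hab (ha.trans hb.symm), fun hc ↦ hne hac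
        (ha.trans hc.symm), hne hbc⟩
    · by_cases hb : (b : W.geomPoints) = 0
      · exact ⟨a, c, mem2 a, mem2 c, ha, fun hc ↦ hne hbc (hb.trans hc.symm), hne hac⟩
      · exact ⟨a, b, mem2 a, mem2 b, ha, hb, hne hab⟩
  have hordP : addOrderOf P = 2 := addOrderOf_eq_prime hP2 hP0
  have hordQ : addOrderOf Q = 2 := addOrderOf_eq_prime hQ2 hQ0
  /- A generator `s₀` of the stable line `H`, and a point `T₀ ∈ E[p] ∖ H`. -/
  obtain ⟨s₀, hs₀H, hs₀0, hHeq⟩ := exists_eq_zmultiples_of_ne_bot_of_ne_top W p H hbot htop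
  have hs₀0' : (s₀ : W.geomPoints) ≠ 0 := fun h ↦ hs₀0 (Subtype.ext h)
  have hmemp : ∀ x : geomTorsion W (p : ℤ), p • (x : W.geomPoints) = 0 := fun x ↦ by
    have h := (mem_torsionPoints_iff _ _ (x : W.geomPoints)).mp x.2
    rwa [natCast_zsmul] at h
  have hords₀ : addOrderOf (s₀ : W.geomPoints) = p := addOrderOf_eq_prime (hmemp s₀) hs₀0'
  rcases hH with hfix | hquot
  · /- Case 1: `Γ_ℚ` fixes `H` pointwise: `E(ℚ) ⊇ ℤ/2 ⊕ ℤ/2 ⊕ ℤ/p`. -/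
    refine false_of_mazur_torsion_of_forall_smul_eq W (hMT _) hp h5 hordP hordQ hPQ hords₀
      (fun σ ↦ h2 σ P hP2) (fun σ ↦ h2 σ Q hQ2) fun σ ↦ ?_
    have := hfix σ s₀ hs₀H
    simpa only [AddSubgroup.torsionBy.coe_smul] using congrArg Subtype.val this
  · /- Case 2: `Γ_ℚ` acts trivially on `E[p]/H`: pass to `E' = E/H`. -/
    obtain ⟨T₀, hT₀⟩ : ∃ T₀ : geomTorsion W (p : ℤ), T₀ ∉ H := by
      by_contra h
      push Not at h
      exact htop (eq_top_iff.mpr fun x _ ↦ h x)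
    set S : AddSubgroup W.geomPoints := H.map (geomTorsion W (p : ℤ)).subtype with hS
    have hSmem : ∀ {x : W.geomPoints}, x ∈ S ↔ ∃ y : geomTorsion W (p : ℤ), y ∈ H ∧ (y : _) = x :=
      fun {x} ↦ by simp only [hS, AddSubgroup.mem_map, AddSubgroup.coe_subtype]
    have hScard : Nat.card S = p := by
      have hHcard : Nat.card H = p := by
        rw [hHeq, Nat.card_zmultiples, ← AddSubgroup.addOrderOf_coe]
        exact hords₀
      rw [← hHcard]
      exact Nat.card_congr (H.equivMapOfInjective _ (geomTorsion W (p : ℤ)).subtype_injective).symm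
    have hSfin : (S : Set W.geomPoints).Finite := by
      have h : Nat.card S ≠ 0 := by rw [hScard]; exact hp.ne_zero
      exact Nat.finite_of_card_ne_zero h
    have hSstab : ∀ (σ : Field.absoluteGaloisGroup ℚ) (x : W.geomPoints), x ∈ S → σ • x ∈ S := by
      intro σ x hx
      obtain ⟨y, hy, rfl⟩ := hSmem.mp hx
      exact hSmem.mpr ⟨σ • y, hstab σ y hy, rfl⟩
    obtain ⟨W', hW', g, -, hker, -, -⟩ :=
      exists_isogeny_ker_eq_and_comp_eq_nsmul_holds (W := W) S hSfin hSstab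
    haveI := hW'
    -- membership in `S = ker g` forces `p`-torsion
    have hSp : ∀ {x : W.geomPoints}, x ∈ S → p • x = 0 := fun hx ↦ by
      obtain ⟨y, -, rfl⟩ := hSmem.mp hx
      exact hmemp y
    have hker' : ∀ {x : W.geomPoints}, g x = 0 ↔ x ∈ S := fun {x} ↦ by
      rw [← hker]; rfl
    -- the images of `P`, `Q`, `T₀`
    have hgP0 : g P ≠ 0 := fun h ↦ hP0 (eq_zero_of_two_nsmul_of_prime_nsmul hp hp2 hP2
      (hSp (hker'.mp h)))
    have hgQ0 : g Q ≠ 0 := fun h ↦ hQ0 (eq_zero_of_two_nsmul_of_prime_nsmul hp hp2 hQ2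
      (hSp (hker'.mp h)))
    have hgPQ : g P ≠ g Q := fun h ↦ by
      have h0 : g (P - Q) = 0 := by rw [map_sub, h, sub_self]
      have h2PQ : 2 • (P - Q) = 0 := by rw [nsmul_sub, hP2, hQ2, sub_self]
      exact hPQ (sub_eq_zero.mp (eq_zero_of_two_nsmul_of_prime_nsmul hp hp2 h2PQ
        (hSp (hker'.mp h0))))
    have hgT0 : g (T₀ : W.geomPoints) ≠ 0 := fun h ↦ by
      obtain ⟨y, hy, hyT⟩ := hSmem.mp (hker'.mp h)
      exact hT₀ (Subtype.ext hyT ▸ hy)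
    have hordgP : addOrderOf (g P) = 2 :=
      addOrderOf_eq_prime (by rw [← map_nsmul, hP2, map_zero]) hgP0
    have hordgQ : addOrderOf (g Q) = 2 :=
      addOrderOf_eq_prime (by rw [← map_nsmul, hQ2, map_zero]) hgQ0
    have hordgT : addOrderOf (g (T₀ : W.geomPoints)) = p :=
      addOrderOf_eq_prime (by rw [← map_nsmul, hmemp T₀, map_zero]) hgT0
    refine false_of_mazur_torsion_of_forall_smul_eq W' (hMT _) hp h5 hordgP hordgQ hgPQ hordgT
      (fun σ ↦ by rw [← g.map_smul, h2 σ P hP2]) (fun σ ↦ by rw [← g.map_smul, h2 σ Q hQ2])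
      fun σ ↦ ?_
    -- `σ • T₀ - T₀ ∈ H`, so `g` identifies `σ • g T₀ = g (σ • T₀)` with `g T₀`
    have hmem : σ • (T₀ : W.geomPoints) - T₀ ∈ S := by
      refine hSmem.mpr ⟨σ • T₀ - T₀, hquot σ T₀, ?_⟩
      simp only [AddSubgroup.coe_sub, AddSubgroup.torsionBy.coe_smul]
    have h0 : g (σ • (T₀ : W.geomPoints) - T₀) = 0 := hker'.mpr hmem
    rw [map_sub, sub_eq_zero] at h0
    rw [← g.map_smul, h0]

end Literature.NumberTheory.EllipticCurves
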